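import Mathlib
import Literature.Barriers.MatrixMultiplication.NormalizerBarrier

/-!
# Graded normalizer / permutability count for subgroup identity designs (negative lemma for the
crux `SubgroupIdentityDesigns`, stmt-MatrixMultiplication-14079)

Abstract setting of the crux `LevelGradedCohnUmans.SubgroupIdentityDesigns`: a finite group `G`, a
BI-INVARIANT test space `J ≤ ℂ^G` (in the crux `J = F_k`, the Fourier-rank-`≤ k` functions on
`GL_m(𝔽_p)`, bi-invariant because `rk(aMb) = rk M`), three subgroups `H₁, H₂, H₃ ≤ G` with the
subgroup triple product property (`Literature.Barriers.MatrixMultiplication.SubgroupTPP`) and ONE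
identity test `f ∈ J`, `f 1 = 1`, `f (a b c) = 0` for `a ∈ H₁, b ∈ H₂, c ∈ H₃`, `abc ≠ 1`.

## Results (all sorry-free, axioms `propext`, `Classical.choice`, `Quot.sound`)

* `idTest_apply_eq_ite` — the read-out: `f (x y z) = [x = 1 ∧ y = 1 ∧ z = 1]` on `H₁ H₂ H₃`.
* `card_mul_card_mul_card_le_finrank_of_conj_right` — **GRADED PERMUTABILITY COUNT**: if
  `K ≤ H₂` conjugates `H₃` into the product set `H₂H₃` (`b h b⁻¹ ∈ H₂H₃` for `b ∈ K`, `h ∈ H₃`), then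
  `|H₁| · |K| · |H₃| ≤ dim J`.  The probes `g ↦ f (a⁻¹ g c⁻¹ b⁻¹)`, `(a, b, c) ∈ H₁ × K × H₃`, lie in
  `J` (bi-invariance) and are biorthogonal to the evaluations at the products `a' b' c'`, because
  `a⁻¹ (a' b' c') c⁻¹ b⁻¹ = (a⁻¹ a') · (b' b⁻¹) · (b (c' c⁻¹) b⁻¹)` and the last factor splits as
  `y z ∈ H₂H₃`; hence the probes are linearly independent in `J`.  GRADED form of the injectivity of
  `H₁ × (N(H₁) ∩ H₂) × H₃ → G` in Blasiak–Cohn–Grochow–Pratt–Umans 2023, Thm 3.6 (tree: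
  `SubgroupTPP.card_mul_card_normalizer_inf_mul_card_le`), with `|G|` replaced by `dim J` and the
  normaliser replaced by the larger "conjugates into `H₂H₃`" subgroup.
* `card_mul_card_mul_card_le_finrank_of_conj_left` — the mirror count with `K ≤ H₂` conjugating `H₁`
  into `H₁H₂` (`b⁻¹ h b ∈ H₁H₂`), probes `g ↦ f (b⁻¹ a⁻¹ g c⁻¹)`.
* `card_mul_card_inf_normalizer_mul_card_le_finrank`, `card_mul_card_normalizer_inf_mul_card_le_finrank`
  — the normaliser special cases `K = H₂ ∩ N_G(H₃)` and `K = N_G(H₁) ∩ H₂`.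
* `volume_le_finrank_of_perm` — if the middle group PERMUTES with an outer one as sets
  (`H₃H₂ ⊆ H₂H₃`, e.g. `H₂H₃` is a subgroup, e.g. `H₂ ≤ N(H₃)`; or `H₂H₁ ⊆ H₁H₂`), the WHOLE volume is
  charged: `|H₁||H₂||H₃| ≤ dim J`; `volume_le_finrank_of_le_normalizer` is the normaliser case.
* Companion file `GradedPlancherel.lean`: `dim J ≤ Σᶠ_{χ ∈ Irr(G) ∩ J} χ(1)^s` for bi-invariant `J`,
  `s ≥ 2`; together: `|H₁||H₂||H₃| ≤ budget_s`, so such triples never satisfy the crux's strict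
  inequality `budget_{2+ε} < V^{(2+ε)/3}` for `ε ≤ 1` (`V^{(2+ε)/3} ≤ V ≤ budget`).

## Why this matters for the crux (informal; the Lean is above)

The only candidate line on the item, the Borel template of card `borel-configuration-identity-test`
(`H₁ = S₁ ⋉ U⁻_{cols ≤ k}`, `H₂ = S₂ ⋉ U⁺_{rows k+1..2k}`, `H₃ = S₃ ⋉ U⁺_{rows ≤ k}` in
`GL_{k²+3k/2}(𝔽_p)`), has `H₂ ≤ N_G(H₃)` (so `H₂H₃` is a group): `U⁺_{rows ≤ k}` is normal in the upper
Borel `B⁺ ∋ H₂`, the diagonal tori `S₂, S₃` commute, and `U⁺_{rows k+1..2k}` commutes with `S₃`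
(whose non-trivial coordinates are `≤ k`).  So its volume would have to satisfy
`V ≤ dim F_k ≈ p^{2mk−k²}`, whereas the card computes `V = Θ((dim F_k)^{3/2}/p)`: the template FAILS
the identity test for every `k, m, p`.  More generally no configuration in which `H₂H₃` or `H₁H₂` is
a subgroup (two pieces inside a common Borel that permute) can be a design.  The same count explains
the kit datum of the card (`(Aff⁺, T₂, U⁻)` not rank-1-separated: `T₂` normalises `U⁻`,
`p²(p−1)² > p³+p²−3p−1`) and excludes every `(U⁻, T, U⁺)`-type triple below the top level.  The crux
itself is NOT refuted: a witness needs a middle group that permutes with neither neighbour (up to a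
sub-polynomial subgroup `K`).
-/

set_option linter.dupNamespace false

noncomputable section

open scoped BigOperators Classical
open Module Literature.Barriers.MatrixMultiplication

namespace Summit.MatrixMultiplication.MatrixMultiplication.Theorems.SubgroupIdentityDesigns.Negative

variable {G : Type} [Group G]

/-! ## The read-out identity and trivial pairwise intersections -/

/-- **Read-out.**  Under the subgroup TPP an identity test `f` (`f 1 = 1`, `f = 0` on
`H₁H₂H₃ ∖ {1}`) reads `f (x y z) = [x = 1 ∧ y = 1 ∧ z = 1]` for `x ∈ H₁, y ∈ H₂, z ∈ H₃`. -/
theorem idTest_apply_eq_ite {H₁ H₂ H₃ : Subgroup G} (htpp : SubgroupTPP H₁ H₂ H₃)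
    {f : G → ℂ} (h1 : f 1 = 1)
    (h0 : ∀ a ∈ H₁, ∀ b ∈ H₂, ∀ c ∈ H₃, a * b * c ≠ 1 → f (a * b * c) = 0)
    {x y z : G} (hx : x ∈ H₁) (hy : y ∈ H₂) (hz : z ∈ H₃) :
    f (x * y * z) = if x = 1 ∧ y = 1 ∧ z = 1 then 1 else 0 := by
  by_cases h : x * y * z = 1
  · obtain ⟨rfl, rfl, rfl⟩ := htpp x hx y hy z hz h
    simp [h1]
  · rw [h0 x hx y hy z hz h, if_neg]
    rintro ⟨rfl, rfl, rfl⟩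
    exact h (by simp)

/-- Under the subgroup TPP, `H₂ ∩ H₃ = 1`. [folklore] -/
theorem eq_one_of_mem_mid_right {H₁ H₂ H₃ : Subgroup G} (htpp : SubgroupTPP H₁ H₂ H₃)
    {t : G} (h2 : t ∈ H₂) (h3 : t ∈ H₃) : t = 1 := by
  have h := htpp 1 H₁.one_mem t⁻¹ (H₂.inv_mem h2) t h3 (by simp)
  exact h.2.2

/-- Under the subgroup TPP, `H₁ ∩ H₂ = 1`. [folklore] -/
theorem eq_one_of_mem_left_mid {H₁ H₂ H₃ : Subgroup G} (htpp : SubgroupTPP H₁ H₂ H₃)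
    {t : G} (h1 : t ∈ H₁) (h2 : t ∈ H₂) : t = 1 := by
  have h := htpp t h1 t⁻¹ (H₂.inv_mem h2) 1 H₃.one_mem (by simp)
  exact h.1

/-! ## The graded permutability / normalizer count -/

section Count

variable [Finite G]

/-- **GRADED PERMUTABILITY COUNT (right).**  For a bi-invariant `J ≤ ℂ^G`, a subgroup TPP triple, an
identity test `f ∈ J`, and a subgroup `K ≤ H₂` conjugating `H₃` into the product set `H₂H₃`:
`|H₁| · |K| · |H₃| ≤ dim J`.  Probes `g ↦ f (a⁻¹ g c⁻¹ b⁻¹)`, `(a,b,c) ∈ H₁ × K × H₃`, are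
biorthogonal to the evaluations at `a' b' c'`:
`a⁻¹ (a'b'c') c⁻¹ b⁻¹ = (a⁻¹a')(b'b⁻¹)(b(c'c⁻¹)b⁻¹) = (a⁻¹a')(b'b⁻¹y) z`. -/
theorem card_mul_card_mul_card_le_finrank_of_conj_right (J : Submodule ℂ (G → ℂ))
    (hJ : ∀ f ∈ J, ∀ a b : G, (fun g : G => f (a * g * b)) ∈ J)
    {H₁ H₂ H₃ : Subgroup G} (htpp : SubgroupTPP H₁ H₂ H₃)
    (K : Subgroup G) (hKH : K ≤ H₂)
    (hK : ∀ b ∈ K, ∀ h ∈ H₃, ∃ y ∈ H₂, ∃ z ∈ H₃, b * h * b⁻¹ = y * z)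
    {f : G → ℂ} (hf : f ∈ J) (h1 : f 1 = 1)
    (h0 : ∀ a ∈ H₁, ∀ b ∈ H₂, ∀ c ∈ H₃, a * b * c ≠ 1 → f (a * b * c) = 0) :
    Nat.card H₁ * Nat.card K * Nat.card H₃ ≤ Module.finrank ℂ J := by
  classical
  haveI : Fintype G := Fintype.ofFinite G
  -- the probes
  let w : ↥H₁ × ↥K × ↥H₃ → J := fun t =>
    ⟨fun g => f ((t.1 : G)⁻¹ * g * ((t.2.2 : G)⁻¹ * (t.2.1 : G)⁻¹)), hJ f hf _ _⟩
  -- biorthogonality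
  have hw : ∀ t s : ↥H₁ × ↥K × ↥H₃,
      (w t : G → ℂ) ((s.1 : G) * (s.2.1 : G) * (s.2.2 : G)) = if t = s then 1 else 0 := by
    rintro ⟨⟨a, ha⟩, ⟨b, hb⟩, ⟨c, hc⟩⟩ ⟨⟨a', ha'⟩, ⟨b', hb'⟩, ⟨c', hc'⟩⟩
    have hbH : b ∈ H₂ := hKH hb
    have hb'H : b' ∈ H₂ := hKH hb'
    obtain ⟨y, hy, z, hz, hyz⟩ := hK b hb (c' * c⁻¹) (H₃.mul_mem hc' (H₃.inv_mem hc))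
    have key : a⁻¹ * (a' * b' * c') * (c⁻¹ * b⁻¹) =
        (a⁻¹ * a') * (b' * b⁻¹) * (b * (c' * c⁻¹) * b⁻¹) := by group
    have hx : a⁻¹ * a' ∈ H₁ := H₁.mul_mem (H₁.inv_mem ha) ha'
    have hy' : b' * b⁻¹ * y ∈ H₂ := H₂.mul_mem (H₂.mul_mem hb'H (H₂.inv_mem hbH)) hy
    show f (a⁻¹ * (a' * b' * c') * (c⁻¹ * b⁻¹)) = _
    rw [key, hyz, show a⁻¹ * a' * (b' * b⁻¹) * (y * z) = a⁻¹ * a' * (b' * b⁻¹ * y) * z by group,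
      idTest_apply_eq_ite htpp h1 h0 hx hy' hz]
    -- the read-out condition is `t = s`
    have hiff : (a⁻¹ * a' = 1 ∧ b' * b⁻¹ * y = 1 ∧ z = 1) ↔ (a = a' ∧ b = b' ∧ c = c') := by
      constructor
      · rintro ⟨e1, e2, e3⟩
        subst e3
        rw [mul_one] at hyz
        -- `c' c⁻¹ = b⁻¹ y b ∈ H₂ ∩ H₃`
        have hcc : c' * c⁻¹ ∈ H₂ := by
          have : c' * c⁻¹ = b⁻¹ * y * b := by rw [← hyz]; group
          rw [this]
          exact H₂.mul_mem (H₂.mul_mem (H₂.inv_mem hbH) hy) hbH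
        have hc1 : c' * c⁻¹ = 1 :=
          eq_one_of_mem_mid_right htpp hcc (H₃.mul_mem hc' (H₃.inv_mem hc))
        have hy1 : y = 1 := by rw [hc1] at hyz; simpa using hyz.symm
        rw [hy1, mul_one, mul_inv_eq_one] at e2
        exact ⟨inv_mul_eq_one.1 e1, e2.symm, (mul_inv_eq_one.1 hc1).symm⟩
      · rintro ⟨rfl, rfl, rfl⟩
        rw [mul_inv_cancel, mul_one, mul_inv_cancel] at hyz
        obtain ⟨-, hy1, hz1⟩ := htpp 1 H₁.one_mem y hy z hz (by simpa using hyz.symm)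
        exact ⟨inv_mul_cancel a, by rw [hy1, mul_inv_cancel, mul_one], hz1⟩
    simp only [hiff, Prod.mk.injEq, Subtype.mk.injEq]
  -- linear independence of the probes
  have hli : LinearIndependent ℂ w := by
    rw [Fintype.linearIndependent_iff]
    intro g hg s
    have := congrArg (fun v : J => (v : G → ℂ) ((s.1 : G) * (s.2.1 : G) * (s.2.2 : G))) hg
    simpa [Submodule.coe_sum, Finset.sum_apply, hw, Finset.sum_ite_eq', Finset.mem_univ] using this
  have hcard : Fintype.card (↥H₁ × ↥K × ↥H₃) ≤ Module.finrank ℂ J := hli.fintype_card_le_finrank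
  rw [← Nat.card_eq_fintype_card, Nat.card_prod, Nat.card_prod] at hcard
  simpa [mul_assoc] using hcard

/-- **GRADED PERMUTABILITY COUNT (left).**  With `K ≤ H₂` conjugating `H₁` into `H₁H₂`
(`b⁻¹ h b ∈ H₁H₂`): `|H₁| · |K| · |H₃| ≤ dim J`, by the probes `g ↦ f (b⁻¹ a⁻¹ g c⁻¹)`:
`b⁻¹ a⁻¹ (a'b'c') c⁻¹ = (b⁻¹(a⁻¹a')b)(b⁻¹b')(c'c⁻¹) = x (y b⁻¹ b')(c'c⁻¹)`. -/
theorem card_mul_card_mul_card_le_finrank_of_conj_left (J : Submodule ℂ (G → ℂ))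
    (hJ : ∀ f ∈ J, ∀ a b : G, (fun g : G => f (a * g * b)) ∈ J)
    {H₁ H₂ H₃ : Subgroup G} (htpp : SubgroupTPP H₁ H₂ H₃)
    (K : Subgroup G) (hKH : K ≤ H₂)
    (hK : ∀ b ∈ K, ∀ h ∈ H₁, ∃ x ∈ H₁, ∃ y ∈ H₂, b⁻¹ * h * b = x * y)
    {f : G → ℂ} (hf : f ∈ J) (h1 : f 1 = 1)
    (h0 : ∀ a ∈ H₁, ∀ b ∈ H₂, ∀ c ∈ H₃, a * b * c ≠ 1 → f (a * b * c) = 0) :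
    Nat.card H₁ * Nat.card K * Nat.card H₃ ≤ Module.finrank ℂ J := by
  classical
  haveI : Fintype G := Fintype.ofFinite G
  let w : ↥H₁ × ↥K × ↥H₃ → J := fun t =>
    ⟨fun g => f (((t.2.1 : G)⁻¹ * (t.1 : G)⁻¹) * g * (t.2.2 : G)⁻¹), hJ f hf _ _⟩
  have hw : ∀ t s : ↥H₁ × ↥K × ↥H₃,
      (w t : G → ℂ) ((s.1 : G) * (s.2.1 : G) * (s.2.2 : G)) = if t = s then 1 else 0 := by
    rintro ⟨⟨a, ha⟩, ⟨b, hb⟩, ⟨c, hc⟩⟩ ⟨⟨a', ha'⟩, ⟨b', hb'⟩, ⟨c', hc'⟩⟩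
    have hbH : b ∈ H₂ := hKH hb
    have hb'H : b' ∈ H₂ := hKH hb'
    obtain ⟨x, hx, y, hy, hxy⟩ := hK b hb (a⁻¹ * a') (H₁.mul_mem (H₁.inv_mem ha) ha')
    have key : b⁻¹ * a⁻¹ * (a' * b' * c') * c⁻¹ =
        (b⁻¹ * (a⁻¹ * a') * b) * (b⁻¹ * b') * (c' * c⁻¹) := by group
    have hy' : y * (b⁻¹ * b') ∈ H₂ := H₂.mul_mem hy (H₂.mul_mem (H₂.inv_mem hbH) hb'H)
    have hz : c' * c⁻¹ ∈ H₃ := H₃.mul_mem hc' (H₃.inv_mem hc)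
    show f (b⁻¹ * a⁻¹ * (a' * b' * c') * c⁻¹) = _
    rw [key, hxy, show x * y * (b⁻¹ * b') * (c' * c⁻¹) = x * (y * (b⁻¹ * b')) * (c' * c⁻¹) by group,
      idTest_apply_eq_ite htpp h1 h0 hx hy' hz]
    have hiff : (x = 1 ∧ y * (b⁻¹ * b') = 1 ∧ c' * c⁻¹ = 1) ↔ (a = a' ∧ b = b' ∧ c = c') := by
      constructor
      · rintro ⟨e1, e2, e3⟩
        subst e1
        rw [one_mul] at hxy
        -- `a⁻¹ a' = b y b⁻¹ ∈ H₁ ∩ H₂`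
        have haa : a⁻¹ * a' ∈ H₂ := by
          have : a⁻¹ * a' = b * y * b⁻¹ := by rw [← hxy]; group
          rw [this]
          exact H₂.mul_mem (H₂.mul_mem hbH hy) (H₂.inv_mem hbH)
        have ha1 : a⁻¹ * a' = 1 :=
          eq_one_of_mem_left_mid htpp (H₁.mul_mem (H₁.inv_mem ha) ha') haa
        have hy1 : y = 1 := by rw [ha1] at hxy; simpa using hxy.symm
        rw [hy1, one_mul, inv_mul_eq_one] at e2
        exact ⟨inv_mul_eq_one.1 ha1, e2, (mul_inv_eq_one.1 e3).symm⟩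
      · rintro ⟨rfl, rfl, rfl⟩
        rw [inv_mul_cancel, mul_one, inv_mul_cancel] at hxy
        obtain ⟨hx1, hy1, -⟩ := htpp x hx y hy 1 H₃.one_mem (by simpa using hxy.symm)
        exact ⟨hx1, by rw [hy1, inv_mul_cancel, mul_one], mul_inv_cancel c⟩
    simp only [hiff, Prod.mk.injEq, Subtype.mk.injEq]
  have hli : LinearIndependent ℂ w := by
    rw [Fintype.linearIndependent_iff]
    intro g hg s
    have := congrArg (fun v : J => (v : G → ℂ) ((s.1 : G) * (s.2.1 : G) * (s.2.2 : G))) hg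
    simpa [Submodule.coe_sum, Finset.sum_apply, hw, Finset.sum_ite_eq', Finset.mem_univ] using this
  have hcard : Fintype.card (↥H₁ × ↥K × ↥H₃) ≤ Module.finrank ℂ J := hli.fintype_card_le_finrank
  rw [← Nat.card_eq_fintype_card, Nat.card_prod, Nat.card_prod] at hcard
  simpa [mul_assoc] using hcard

/-- **GRADED NORMALIZER COUNT (right)**: `|H₁| · |H₂ ∩ N_G(H₃)| · |H₃| ≤ dim J` — the case
`K = H₂ ∩ N(H₃)` (`b h b⁻¹ ∈ H₃ = 1 · H₃`).  Graded form of BCGPU 2023 Thm 3.6 (`|G| ↦ dim J`). -/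
theorem card_mul_card_inf_normalizer_mul_card_le_finrank (J : Submodule ℂ (G → ℂ))
    (hJ : ∀ f ∈ J, ∀ a b : G, (fun g : G => f (a * g * b)) ∈ J)
    {H₁ H₂ H₃ : Subgroup G} (htpp : SubgroupTPP H₁ H₂ H₃)
    {f : G → ℂ} (hf : f ∈ J) (h1 : f 1 = 1)
    (h0 : ∀ a ∈ H₁, ∀ b ∈ H₂, ∀ c ∈ H₃, a * b * c ≠ 1 → f (a * b * c) = 0) :
    Nat.card H₁ * Nat.card ↥(H₂ ⊓ Subgroup.normalizer (H₃ : Set G)) * Nat.card H₃ ≤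
      Module.finrank ℂ J :=
  card_mul_card_mul_card_le_finrank_of_conj_right J hJ htpp _ inf_le_left
    (fun b hb h hh => ⟨1, H₂.one_mem, b * h * b⁻¹,
      (Subgroup.mem_normalizer_iff.1 (Subgroup.mem_inf.1 hb).2 h).1 hh, by rw [one_mul]⟩) hf h1 h0

/-- **GRADED NORMALIZER COUNT (left)**: `|H₁| · |N_G(H₁) ∩ H₂| · |H₃| ≤ dim J` — the case
`K = N(H₁) ∩ H₂` (`b⁻¹ h b ∈ H₁ = H₁ · 1`). -/
theorem card_mul_card_normalizer_inf_mul_card_le_finrank (J : Submodule ℂ (G → ℂ))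
    (hJ : ∀ f ∈ J, ∀ a b : G, (fun g : G => f (a * g * b)) ∈ J)
    {H₁ H₂ H₃ : Subgroup G} (htpp : SubgroupTPP H₁ H₂ H₃)
    {f : G → ℂ} (hf : f ∈ J) (h1 : f 1 = 1)
    (h0 : ∀ a ∈ H₁, ∀ b ∈ H₂, ∀ c ∈ H₃, a * b * c ≠ 1 → f (a * b * c) = 0) :
    Nat.card H₁ * Nat.card ↥(Subgroup.normalizer (H₁ : Set G) ⊓ H₂) * Nat.card H₃ ≤
      Module.finrank ℂ J :=
  card_mul_card_mul_card_le_finrank_of_conj_left J hJ htpp _ inf_le_right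
    (fun b hb h hh => by
      have hbN : b⁻¹ ∈ Subgroup.normalizer (H₁ : Set G) :=
        Subgroup.inv_mem _ (Subgroup.mem_inf.1 hb).1
      have hmem := (Subgroup.mem_normalizer_iff.1 hbN h).1 hh
      rw [inv_inv] at hmem
      exact ⟨b⁻¹ * h * b, hmem, 1, H₂.one_mem, by rw [mul_one]⟩) hf h1 h0

/-- **The whole volume is charged when the middle group PERMUTES with an outer one.**  If
`H₃H₂ ⊆ H₂H₃` (equivalently `H₂H₃` is a subgroup; e.g. `H₂ ≤ N(H₃)`) or `H₂H₁ ⊆ H₁H₂`, then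
`|H₁| |H₂| |H₃| ≤ dim J`. -/
theorem volume_le_finrank_of_perm (J : Submodule ℂ (G → ℂ))
    (hJ : ∀ f ∈ J, ∀ a b : G, (fun g : G => f (a * g * b)) ∈ J)
    {H₁ H₂ H₃ : Subgroup G} (htpp : SubgroupTPP H₁ H₂ H₃)
    (hperm : (∀ z ∈ H₃, ∀ y ∈ H₂, ∃ y' ∈ H₂, ∃ z' ∈ H₃, z * y = y' * z') ∨
      (∀ y ∈ H₂, ∀ x ∈ H₁, ∃ x' ∈ H₁, ∃ y' ∈ H₂, y * x = x' * y'))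
    {f : G → ℂ} (hf : f ∈ J) (h1 : f 1 = 1)
    (h0 : ∀ a ∈ H₁, ∀ b ∈ H₂, ∀ c ∈ H₃, a * b * c ≠ 1 → f (a * b * c) = 0) :
    Nat.card H₁ * Nat.card H₂ * Nat.card H₃ ≤ Module.finrank ℂ J := by
  rcases hperm with hperm | hperm
  · refine card_mul_card_mul_card_le_finrank_of_conj_right J hJ htpp H₂ le_rfl
      (fun b hb h hh => ?_) hf h1 h0
    obtain ⟨y', hy', z', hz', he⟩ := hperm h hh b⁻¹ (H₂.inv_mem hb)
    exact ⟨b * y', H₂.mul_mem hb hy', z', hz', by rw [mul_assoc, he, ← mul_assoc]⟩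
  · refine card_mul_card_mul_card_le_finrank_of_conj_left J hJ htpp H₂ le_rfl
      (fun b hb h hh => ?_) hf h1 h0
    obtain ⟨x', hx', y', hy', he⟩ := hperm b⁻¹ (H₂.inv_mem hb) h hh
    exact ⟨x', hx', y' * b, H₂.mul_mem hy' hb, by rw [he, mul_assoc]⟩

/-- **The whole volume is charged when the middle group NORMALISES an outer one.**  If
`H₂ ≤ N_G(H₃)` or `H₂ ≤ N_G(H₁)`, then `|H₁| |H₂| |H₃| ≤ dim J`. -/
theorem volume_le_finrank_of_le_normalizer (J : Submodule ℂ (G → ℂ))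
    (hJ : ∀ f ∈ J, ∀ a b : G, (fun g : G => f (a * g * b)) ∈ J)
    {H₁ H₂ H₃ : Subgroup G} (htpp : SubgroupTPP H₁ H₂ H₃)
    (hle : H₂ ≤ Subgroup.normalizer (H₃ : Set G) ∨ H₂ ≤ Subgroup.normalizer (H₁ : Set G))
    {f : G → ℂ} (hf : f ∈ J) (h1 : f 1 = 1)
    (h0 : ∀ a ∈ H₁, ∀ b ∈ H₂, ∀ c ∈ H₃, a * b * c ≠ 1 → f (a * b * c) = 0) :
    Nat.card H₁ * Nat.card H₂ * Nat.card H₃ ≤ Module.finrank ℂ J := by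
  rcases hle with hle | hle
  · have h := card_mul_card_inf_normalizer_mul_card_le_finrank J hJ htpp hf h1 h0
    rwa [inf_eq_left.2 hle] at h
  · have h := card_mul_card_normalizer_inf_mul_card_le_finrank J hJ htpp hf h1 h0
    rwa [inf_eq_right.2 hle] at h

end Count

end Summit.MatrixMultiplication.MatrixMultiplication.Theorems.SubgroupIdentityDesigns.Negative

end
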